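import Summits.RiemannHypothesis.RiemannHypothesis.Theorems.TiltedLandingLaw421R3SinkBdry

/-!
# «SinkMirrorNeg» v1 — 102's corner conjecture `CornerDominanceSig` is FALSE AS TYPED for children LEFT of the axis (`Re w < xv`):
an explicit rational cone datum, decided by `norm_num` through 110's real closed form (C1 desk, rh-idea-5 g39; files-only; SUPPORT, K + one decided instance)

ONE import: TREE «SinkBdry» (110, `…Theorems.TiltedLandingLaw421R3SinkBdry`).  Namespace `RhW08.SinkMirrorNeg`; nothing re-declared.
DATUM (window `R = 2`, scale `s = 1/3`, box top `h = 3/5`, weight `y0 = 1`, child `w = xv − 1/10 + (11/20)·i`, parent `v = xv + (29/50)·i`): all thirteen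
hypotheses of `CornerDominanceSig` hold (`6s ≤ R`, `3h < R`, `0 < Im w < Im v ≤ h`, `Im v − s/4 < Im w`, nested `δ² + t² ≤ Y²`, cone `|δ|(R − |δ|) < t²`,
`0 ≤ y0 ≤ 1`), yet at the boundary point `u = xv − R/2` (left inner column, height `b = 0`) the kernel numerator `N(u) = −3824/46369 ≈ −0.0825` exceeds
`σ*·c(u)` because BOTH top-corner ratios are NEGATIVE (`σ* = r₊ = −112887198/295243091 ≈ −0.382`, `c(u) = 88/89 > 0`): `σ*·c(u) − N(u) ≈ −0.296 < 0`.
DIAGNOSIS (K, no law): `realTwoPoint` hard-wires the cut direction `e = −1`; the coordinate forms are ODD / EVEN under the mirror `(δ, ξ) ↦ (−δ, −ξ)`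
(`twoPointNForm_mirror`, `pairCForm_mirror`), so corner dominance for a child at `δ < 0` with `e = −1` cuts is NOT the mirror image of the certified
`δ > 0` case — the mirror image uses `e = +1` cuts (admissible under `CutsAdmissible`, which only asks `‖e‖ = 1`).  CONSEQUENCE: corner-type
conjectures are to be stated for `xv ≤ Re w`; the `Re w < xv` children of `CertificatesExistSig` are served by the mirrored family (separate K-lemma).
Every K-theorem of the sink modules stands (they assert no law); exact certificates computed at `d = Re w − xv ≥ 0` cover exactly the true half.
LEVEL: SUPPORT (K) + one decided instance; a refuted conjecture-`def` is negative knowledge.  No `sorry`.  Nothing here bears on the truth of RH;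
RH is not proved; ⟨33346⟩/⟨33347⟩ OPEN; `CertificatesExistSig` OPEN; checked ≠ keyed ≠ landed ≠ proved.
-/

noncomputable section

open Complex
open scoped ComplexConjugate
open RhW08.SinkTemplate RhW08.SinkBdry

namespace RhW08.SinkMirrorNeg

/-- ODDNESS of the kernel numerator form under the mirror `(δ, ξ) ↦ (−δ, −ξ)` (K). -/
theorem twoPointNForm_mirror (δ t h y0 ξ b : ℝ) : twoPointNForm (-δ) t h y0 (-ξ) b = -twoPointNForm δ t h y0 ξ b := by
  unfold twoPointNForm
  have e1 : (-δ - -ξ) ^ 2 = (δ - ξ) ^ 2 := by ring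
  have e2 : (-ξ) ^ 2 = ξ ^ 2 := by ring
  rw [e1, e2]
  ring

/-- EVENNESS of `c` under the same mirror (K). -/
theorem pairCForm_mirror (δ t ξ b : ℝ) : pairCForm (-δ) t (-ξ) b = pairCForm δ t ξ b := by
  unfold pairCForm
  have e1 : (-δ - -ξ) ^ 2 = (δ - ξ) ^ 2 := by ring
  rw [e1]

/-- THE DECIDED INSTANCE: the real closed form of the corner conjecture fails at `R = 2, s = 1/3, h = 3/5, y0 = 1, δ = −1/10, t = 11/20, Y = 29/50`
(left inner column, height `0`). -/
theorem not_cornerDominanceRealSig : ¬ CornerDominanceRealSig := by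
  intro hC
  have hK := hC 2 (1 / 3) (3 / 5) 1 (-1 / 10) (11 / 20) (29 / 50) (by norm_num) (by norm_num) (by norm_num) (by norm_num) (by norm_num)
    (by norm_num) (by norm_num) (by norm_num) (by norm_num) (by rw [abs_of_neg (by norm_num)]; norm_num) (by norm_num) (by norm_num)
  obtain ⟨-, hcol, -, -⟩ := hK
  have h0 := hcol 0 le_rfl (by norm_num)
  simp only [cornerSigmaForm, twoPointNForm, pairCForm] at h0
  norm_num [max_def] at h0

/-- Hence 102's `CornerDominanceSig` is false as typed (via 110's `cornerDominanceSig_iff`). -/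
theorem not_cornerDominanceSig : ¬ CornerDominanceSig := fun h =>
  not_cornerDominanceRealSig (cornerDominanceSig_iff.1 h)

end RhW08.SinkMirrorNeg

end
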